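import Summits.SmoothPoincare4.SmoothPoincare4.Theorems.AcyclicBisectionExists.Negative.Sphere

/-!
# `AcyclicBisectionExists` — negative-side support (6): an acyclic witness forces `b₄(M) = 1`

§12 of the standing disprover's work file `Cruxes/AcyclicBisectionExists/Disproof.lean` (gen 3):
`Witness.finrank_homology_four_of_acyclicRight` / `finrank_homology_four_of_acyclic` — in
`H₄(e₂W₂) → H₄(M) → H₄(M, e₂W₂) → H₃(e₂W₂)` the outer groups vanish, so
`H₄(M; ℚ) ≅ H₄(M, e₂W₂; ℚ) ≅ H₄(W₁, ∂W₁; ℚ) ≅ H⁰(W₁; ℚ) ≅ ℚ`; `rationalHomologySphere_of_acyclic`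
— the full homological content of the crux's ∃-body: a path-connected `M` carrying a ℚ-acyclic
Stein bisection is a rational homology 4-SPHERE (degrees `1–3` from `isZero_homology_of_acyclic`,
degree `4` here).  So `M ≃ₕ S⁴` is consumed homologically through `b₁ = b₂ = b₃ = 0` (the `ℂℙ²`
refutation of `Closed.lean`) AND `b₄ = 1`, which excludes every closed connected non-orientable
4-manifold (`H₄ = 0`), e.g. `ℝℙ⁴` (rationally acyclic in degrees `1–3` like a homotopy sphere).
-/

noncomputable section

-- the prescribed namespace `Summit.<P>.<Sub>.…` duplicates `SmoothPoincare4` (P = Sub)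
set_option linter.dupNamespace false

open scoped Manifold ContDiff Topology ContinuousMap
open Set Function CategoryTheory CategoryTheory.Limits
open Literature.Geometry.Symplectic Literature.AlgebraicTopology.SingularHomology

namespace Summit.SmoothPoincare4.SmoothPoincare4.Theorems.AcyclicBisectionExists.Negative

open Summit.SmoothPoincare4.SmoothPoincare4.Theses.ConvexBisection

/-- Local notation: the model space `ℝ⁴`. -/
local notation "𝔼4" => EuclideanSpace ℝ (Fin 4)

namespace Witness

open Literature.Topology.FourManifolds

variable {M : Type} [TopologicalSpace M] [ChartedSpace 𝔼4 M] (B : Witness M)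
variable [T2Space M] [SecondCountableTopology M] [IsManifold (𝓡 4) ∞ M] [Nonempty M]

/-- **An acyclic right half forces `b₄(M) = 1`** (both halves connected): in
`H₄(e₂W₂) → H₄(M) → H₄(M, e₂W₂) → H₃(e₂W₂)` the outer groups vanish (`W₂` connected with
nonempty boundary has no `H₄`; `H₃(W₂; ℚ) = 0` by acyclicity), so
`H₄(M; ℚ) ≅ H₄(M, e₂W₂; ℚ) ≅ H₄(W₁, ∂W₁; ℚ) ≅ H⁰(W₁; ℚ) ≅ ℚ` (`finrank_relHomology_four`).
[folklore] -/
theorem finrank_homology_four_of_acyclicRight [ConnectedSpace B.W₁] [ConnectedSpace B.W₂]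
    (h₂ : B.AcyclicRight) : Module.finrank ℚ (singularHomology ℚ ℚ M 4) = 1 := by
  have eA : B.W₂ ≃ₜ ↥(range B.e₂) := B.emb₂.isEmbedding.toHomeomorph
  have hA4 : IsZero (singularHomology ℚ ℚ ↥(range B.e₂) 4) :=
    (B.isZero_homology₂_of_four_le le_rfl).of_iso (singularHomology.mapIso ℚ ℚ eA 4).symm
  have hA3 : IsZero (singularHomology ℚ ℚ ↥(range B.e₂) 3) :=
    (h₂ 3 (by norm_num)).of_iso (singularHomology.mapIso ℚ ℚ eA 3).symm
  have hmono : Mono (relativeSingularHomology.ofAbsolute ℚ ℚ M (range B.e₂) 4) :=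
    (relativeSingularHomology.exact_map_ofAbsolute ℚ ℚ (range B.e₂) 4).mono_g (hA4.eq_of_src _ _)
  have hepi : Epi (relativeSingularHomology.ofAbsolute ℚ ℚ M (range B.e₂) 4) :=
    (relativeSingularHomology.exact_ofAbsolute_δ ℚ ℚ (range B.e₂) 3).epi_f (hA3.eq_of_tgt _ _)
  haveI := isIso_of_mono_of_epi (relativeSingularHomology.ofAbsolute ℚ ℚ M (range B.e₂) 4)
  rw [(asIso (relativeSingularHomology.ofAbsolute ℚ ℚ M (range B.e₂) 4)).toLinearEquiv.finrank_eq]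
  exact B.finrank_relHomology_four

/-- **`b₄(M) = 1` for every path-connected `M` carrying an acyclic witness** (the halves are
automatically connected, `connectedSpace₁_of_acyclic`). [folklore] -/
theorem finrank_homology_four_of_acyclic [PathConnectedSpace M] (hB : B.Acyclic) :
    Module.finrank ℚ (singularHomology ℚ ℚ M 4) = 1 := by
  haveI := B.connectedSpace₁_of_acyclic hB
  haveI := B.connectedSpace₂_of_acyclic hB
  exact B.finrank_homology_four_of_acyclicRight hB.right

/-- **The full homological content of the ∃-body: a path-connected `M` with a ℚ-acyclic Stein
bisection is a rational homology 4-sphere** — `H₁ = H₂ = H₃ = 0` AND `dim H₄ = 1`.  The latter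
excludes every closed connected NON-orientable 4-manifold (`H₄(M; ℤ) = 0`, Hatcher 3.26(b), tree
`isZero_singularHomology_top_of_not_isOrientableOver_int_holds`; `H₄(M; ℚ) = 0` by UCT), e.g.
`ℝℙ⁴`.  What the ∃-body does NOT see is `π₁`: on paper the doubles `D(B_{p,q})` of the Stein
rational balls are ℚHS⁴'s with `π₁ = ℤ/p` carrying acyclic Stein bisections (`Doubles.lean`).
[folklore] -/
theorem rationalHomologySphere_of_acyclic [PathConnectedSpace M] (hB : B.Acyclic) :
    (∀ k, 0 < k → k ≤ 3 → IsZero (singularHomology ℚ ℚ M k)) ∧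
      Module.finrank ℚ (singularHomology ℚ ℚ M 4) = 1 :=
  ⟨fun _ hk hk3 => B.isZero_homology_of_acyclic hB hk hk3, B.finrank_homology_four_of_acyclic hB⟩

/-- **No ℚ-acyclic Stein bisection on a path-connected `M` with `b₄(M) ≠ 1`** (e.g. a closed
connected non-orientable `M`, where `H₄(M; ℚ) = 0`; or a non-compact `M`). [folklore] -/
theorem not_acyclic_of_finrank_homology_four_ne_one [PathConnectedSpace M]
    (hM : Module.finrank ℚ (singularHomology ℚ ℚ M 4) ≠ 1) : ¬ B.Acyclic := fun hB =>
  hM (B.finrank_homology_four_of_acyclic hB)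

end Witness

/-- `HasAcyclicSteinBisection M` forces `b₄(M) = 1` (path-connected `M`). [folklore] -/
theorem finrank_homology_four_of_hasAcyclicSteinBisection {M : Type} [TopologicalSpace M]
    [ChartedSpace 𝔼4 M] [T2Space M] [SecondCountableTopology M] [IsManifold (𝓡 4) ∞ M]
    [Nonempty M] [PathConnectedSpace M] (h : HasAcyclicSteinBisection M) :
    Module.finrank ℚ (singularHomology ℚ ℚ M 4) = 1 := by
  obtain ⟨B, hB⟩ := h
  exact B.finrank_homology_four_of_acyclic hB

end Summit.SmoothPoincare4.SmoothPoincare4.Theorems.AcyclicBisectionExists.Negative
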